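import Mathlib
import HarnessLib

/-!
# Far-edge descent, kernel XLII-A (1/3) — the multiplicative coordinate and the wedge (model level)

Kernel XL-A (`FarEdgeDescentWidthTransform`) reduced the width cascade of the β-dial to two scalars
per node, the SHARE `λ = L/(Q+βL)` and the NARROWNESS `V(z) = p(z)/(z·L) ∈ [0,1]`, with the exact
product rules `λ_P = λ + λ' − (2β−1)λλ'` and
`V_P·λ_P = λ'(1−βλ)·V' + λ(1−βλ')·V + z·λλ'·V·V'`.  Kernel XLI (`FarEdgeDescentFloorDial`,
`FarEdgeDescentTreeCap`) typed the cap conjecture XL-D over all binary schedules `Sched` and proved it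
along chains and caterpillars; memo g61 §3 recorded why the tree case resisted: every potential in
`V` alone fails at LIGHT bases, and the pair criterion is false on the full box `λ ≤ 1/β, V ≤ 1`.

Kernel XLII-A (three files: `…FixedPointWedge`, `…FixedPointPinning`, `…PinnedSchedules`) isolates
the structural law that removes the bad corner of the box.  Write `d := 1 − (2β−1)·λ` (so `d = 0`
is the fixed point `λ* = 1/(2β−1)` of the share map, `d < 0` the LIGHT side, `d > 0` the HEAVY side,
and `β−1+β·d ≥ 0 ⟺ λ ≤ 1/β`).  Then `d` is MULTIPLICATIVE (`d_P = d·d'`), and two inequalities are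
closed under products and hold at every base:
* WEDGE (W): `β·(−d) ≤ (β−1)·V` — a light node is narrow in proportion to its lightness;
* PINNING (Q): `|d| ≤ V²` — a node whose legs have spread (`V` small) is pinned to the fixed point,
  quadratically, and a very heavy node is narrow.

THIS FILE: `dfix_mul` (multiplicativity of `d`), `narrow_prod_dform` (the XL-A product rule in
`d`-coordinates: `V_P·(2β−1)(1−dd') = (1−d')(β−1+βd)V' + (1−d)(β−1+βd')V + z(1−d)(1−d')VV'`),
`one_sub_dd_pos`, `narrow_prod_nonneg` (`V_P ≥ 0`) and `wedge_closure`: (W) for both factors ⟹ (W)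
for the product, for every `1 < β`, `0 ≤ z` (only the mixed-sign case has content; certificate
`(1−d)(β−1+βd') − (2β−1)d'(1−dd') = (1−d')·((1−d)(β−1) − (2β−1)dd')`).

HONEST FRAMING: MODEL level (real numbers; the dictionary node ↦ `(Q, p)` is kernels XXXIX-K/XL-A);
no `sorry`, no new axioms.  Nothing here touches `_root_.MatrixMultiplication` or the `closes` cut
of the route.  References: Schönhage 1981 [Schonhage1981]; Coppersmith–Winograd
[CoppersmithWinograd1990]; kernels XL-A, XLI-A/B; memo g62 (decomp-mm-lens-2).
-/

noncomputable section

set_option linter.dupNamespace false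

namespace Summit.MatrixMultiplication.MatrixMultiplication.Theorems.FarEdgeDescentFixedPointWedge

/-! ## 1. The multiplicative coordinate and the product rule in `d`-form -/

/-- **`d = 1 − (2β−1)λ` is multiplicative** under `λ_P = λ + λ' − (2β−1)λλ'`. -/
theorem dfix_mul (β lam lam' : ℝ) :
    1 - (2 * β - 1) * (lam + lam' - (2 * β - 1) * lam * lam') =
      (1 - (2 * β - 1) * lam) * (1 - (2 * β - 1) * lam') := by
  ring

/-- The narrowness product rule of XL-A in `d`-coordinates (`λ = (1−d)/(2β−1)`):
multiplying `V_P·λ_P = λ'(1−βλ)V' + λ(1−βλ')V + zλλ'VV'` by `(2β−1)²`. -/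
theorem narrow_prod_dform {β lam lam' V V' VP z : ℝ}
    (h : VP * (lam + lam' - (2 * β - 1) * lam * lam') =
      lam' * (1 - β * lam) * V' + lam * (1 - β * lam') * V + z * lam * lam' * V * V') :
    VP * ((2 * β - 1) * (1 - (1 - (2 * β - 1) * lam) * (1 - (2 * β - 1) * lam'))) =
      (1 - (1 - (2 * β - 1) * lam')) * (β - 1 + β * (1 - (2 * β - 1) * lam)) * V' +
      (1 - (1 - (2 * β - 1) * lam)) * (β - 1 + β * (1 - (2 * β - 1) * lam')) * V +
      z * (1 - (1 - (2 * β - 1) * lam)) * (1 - (1 - (2 * β - 1) * lam')) * V * V' := by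
  linear_combination ((2 * β - 1) ^ 2) * h

/-! ## 2. Real-variable closure lemmas

Throughout: `1 < β`; `d, d'` with `β − 1 + β·d ≥ 0` (share at most `1/β`) and `d < 1`
(positive share); `V, V' ≥ 0`; and the `d`-form product rule as hypothesis `hP`. -/

/-- `1 − d·d' > 0` on the admissible range. -/
theorem one_sub_dd_pos {β d d' : ℝ} (hβ : 1 < β) (hd : 0 ≤ β - 1 + β * d) (hd1 : d < 1)
    (hd' : 0 ≤ β - 1 + β * d') (hd1' : d' < 1) : 0 < 1 - d * d' := by
  have h1 : 0 < 1 + d := by nlinarith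
  have h2 : 0 < 1 + d' := by nlinarith
  rcases le_total 0 d with hdp | hdn
  · -- d ≥ 0 : d d' < d ≤ ... use d' < 1
    nlinarith [mul_nonneg hdp (sub_pos.mpr hd1').le]
  · nlinarith [mul_nonneg (neg_nonneg.mpr hdn) (sub_pos.mpr hd1').le, mul_pos h1 h2]

/-- **The product's narrowness is nonnegative.** -/
theorem narrow_prod_nonneg {β z d d' V V' VP : ℝ} (hβ : 1 < β) (hz : 0 ≤ z)
    (hd : 0 ≤ β - 1 + β * d) (hd1 : d < 1) (hd' : 0 ≤ β - 1 + β * d') (hd1' : d' < 1)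
    (hV : 0 ≤ V) (hV' : 0 ≤ V')
    (hP : VP * ((2 * β - 1) * (1 - d * d')) =
      (1 - d') * (β - 1 + β * d) * V' + (1 - d) * (β - 1 + β * d') * V +
        z * (1 - d) * (1 - d') * V * V') :
    0 ≤ VP := by
  have hdd := one_sub_dd_pos hβ hd hd1 hd' hd1'
  have hpos : 0 < (2 * β - 1) * (1 - d * d') := mul_pos (by linarith) hdd
  have h1 : 0 ≤ 1 - d := by linarith
  have h2 : 0 ≤ 1 - d' := by linarith
  have hR : 0 ≤ (1 - d') * (β - 1 + β * d) * V' + (1 - d) * (β - 1 + β * d') * V +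
      z * (1 - d) * (1 - d') * V * V' := by positivity
  rw [← hP] at hR
  by_contra hneg
  push Not at hneg
  have : VP * ((2 * β - 1) * (1 - d * d')) < 0 := mul_neg_of_neg_of_pos hneg hpos
  linarith

/-- One mixed-sign case of the wedge closure: `d ≤ 0 ≤ d'`. -/
theorem wedge_closure_aux {β z d d' V V' VP : ℝ} (hβ : 1 < β) (hz : 0 ≤ z)
    (hd : 0 ≤ β - 1 + β * d) (hd1 : d < 1) (hd' : 0 ≤ β - 1 + β * d') (hd1' : d' < 1)
    (hV : 0 ≤ V) (hV' : 0 ≤ V') (hdn : d ≤ 0) (hd'p : 0 ≤ d')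
    (hW : β * (-d) ≤ (β - 1) * V)
    (hP : VP * ((2 * β - 1) * (1 - d * d')) =
      (1 - d') * (β - 1 + β * d) * V' + (1 - d) * (β - 1 + β * d') * V +
        z * (1 - d) * (1 - d') * V * V') :
    β * (-(d * d')) ≤ (β - 1) * VP := by
  have hdd := one_sub_dd_pos hβ hd hd1 hd' hd1'
  have hpos : 0 < (2 * β - 1) * (1 - d * d') := mul_pos (by linarith) hdd
  have h1d : 0 ≤ 1 - d := by linarith
  have h1d' : 0 ≤ 1 - d' := by linarith
  have hdrop : 0 ≤ (1 - d') * (β - 1 + β * d) * V' + z * (1 - d) * (1 - d') * V * V' := by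
    positivity
  have hβ1 : 0 ≤ β - 1 := by linarith
  -- (β-1)·(V_P·X) ≥ (β-1)·T₂
  have h1 : (β - 1) * ((1 - d) * (β - 1 + β * d') * V) ≤
      (β - 1) * (VP * ((2 * β - 1) * (1 - d * d'))) := by
    rw [hP]
    have := mul_nonneg hβ1 hdrop
    nlinarith [this]
  -- (β-1)·T₂ ≥ c·β(−d), c = (1-d)(β-1+βd') ≥ 0
  have hc : 0 ≤ (1 - d) * (β - 1 + β * d') := mul_nonneg h1d hd'
  have h2 : (1 - d) * (β - 1 + β * d') * (β * (-d)) ≤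
      (1 - d) * (β - 1 + β * d') * ((β - 1) * V) := mul_le_mul_of_nonneg_left hW hc
  -- certificate: (2β-1) d' (1-dd') ≤ (1-d)(β-1+βd')
  have hcert : (2 * β - 1) * d' * (1 - d * d') ≤ (1 - d) * (β - 1 + β * d') := by
    have hid : (1 - d) * (β - 1 + β * d') - (2 * β - 1) * d' * (1 - d * d') =
        (1 - d') * ((1 - d) * (β - 1) - (2 * β - 1) * d * d') := by ring
    have hin : 0 ≤ (1 - d) * (β - 1) - (2 * β - 1) * d * d' := by
      have : 0 ≤ (-d) * d' := mul_nonneg (neg_nonneg.mpr hdn) hd'p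
      nlinarith [mul_nonneg h1d hβ1]
    have := mul_nonneg h1d' hin
    linarith
  have hβd : 0 ≤ β * (-d) := mul_nonneg (by linarith) (neg_nonneg.mpr hdn)
  have h3 : (2 * β - 1) * d' * (1 - d * d') * (β * (-d)) ≤
      (1 - d) * (β - 1 + β * d') * (β * (-d)) := mul_le_mul_of_nonneg_right hcert hβd
  have h4 : (β * (-(d * d'))) * ((2 * β - 1) * (1 - d * d')) ≤
      ((β - 1) * VP) * ((2 * β - 1) * (1 - d * d')) := by
    have e1 : (β * (-(d * d'))) * ((2 * β - 1) * (1 - d * d')) =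
        (2 * β - 1) * d' * (1 - d * d') * (β * (-d)) := by ring
    have e2 : ((β - 1) * VP) * ((2 * β - 1) * (1 - d * d')) =
        (β - 1) * (VP * ((2 * β - 1) * (1 - d * d'))) := by ring
    rw [e1, e2]
    linarith [h1, h2, h3]
  exact le_of_mul_le_mul_right h4 hpos

/-- **Wedge closure (W).**  If `β(−d) ≤ (β−1)V` and `β(−d') ≤ (β−1)V'` then
`β(−dd') ≤ (β−1)V_P`.  (Only the mixed-sign case has content; there the certificate is
`(1−d)(β−1+βd') − (2β−1)d'(1−dd') = (1−d')·((1−d)(β−1) − (2β−1)dd') ≥ 0` for `d ≤ 0 ≤ d'`.) -/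
theorem wedge_closure {β z d d' V V' VP : ℝ} (hβ : 1 < β) (hz : 0 ≤ z)
    (hd : 0 ≤ β - 1 + β * d) (hd1 : d < 1) (hd' : 0 ≤ β - 1 + β * d') (hd1' : d' < 1)
    (hV : 0 ≤ V) (hV' : 0 ≤ V')
    (hW : β * (-d) ≤ (β - 1) * V) (hW' : β * (-d') ≤ (β - 1) * V')
    (hP : VP * ((2 * β - 1) * (1 - d * d')) =
      (1 - d') * (β - 1 + β * d) * V' + (1 - d) * (β - 1 + β * d') * V +
        z * (1 - d) * (1 - d') * V * V') :
    β * (-(d * d')) ≤ (β - 1) * VP := by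
  have hVP := narrow_prod_nonneg hβ hz hd hd1 hd' hd1' hV hV' hP
  rcases le_total d 0 with hdn | hdp
  · rcases le_total 0 d' with hd'p | hd'n
    · exact wedge_closure_aux hβ hz hd hd1 hd' hd1' hV hV' hdn hd'p hW hP
    · -- both ≤ 0: d d' ≥ 0
      have : 0 ≤ d * d' := mul_nonneg_of_nonpos_of_nonpos hdn hd'n
      nlinarith
  · rcases le_total 0 d' with hd'p | hd'n
    · have : 0 ≤ d * d' := mul_nonneg hdp hd'p
      nlinarith
    · -- d' ≤ 0 ≤ d: symmetric instance (swap the factors; the product rule is symmetric)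
      have hP' : VP * ((2 * β - 1) * (1 - d' * d)) =
          (1 - d) * (β - 1 + β * d') * V + (1 - d') * (β - 1 + β * d) * V' +
            z * (1 - d') * (1 - d) * V' * V := by
        rw [mul_comm d' d, hP]; ring
      have := wedge_closure_aux hβ hz hd' hd1' hd hd1 hV' hV hd'n hdp hW' hP'
      rw [mul_comm d' d] at this
      exact this

end Summit.MatrixMultiplication.MatrixMultiplication.Theorems.FarEdgeDescentFixedPointWedge
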